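import Summits.RiemannHypothesis.RiemannHypothesis.Theorems.RuelleBandExactFirstBandStubEvenEngine
import Summits.RiemannHypothesis.RiemannHypothesis.Theorems.RuelleBandExactFirstBandStubEvenSymTranslate
import Summits.RiemannHypothesis.RiemannHypothesis.Theorems.RuelleBandExactFirstBandStubEvenExpSum
import Summits.RiemannHypothesis.RiemannHypothesis.Theorems.RuelleBandExactFirstBandStubEvenTestExists
import Summits.RiemannHypothesis.RiemannHypothesis.Theorems.RuelleBandExactFirstBandStubEvenTransfer
import Literature.NumberTheory.LFunctions.WeilGroundEnergyParitySplit
import Literature.NumberTheory.LFunctions.WeilGroundEnergyProofs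
import Literature.NumberTheory.LFunctions.WeilOddGroundState
import Literature.NumberTheory.LFunctions.WeilCriterionConverse
import Literature.NumberTheory.LFunctions.WeilExplicitFormulaProofs
import Literature.NumberTheory.LFunctions.GeneralizedRH
import HarnessLib

/-!
# PF persistence campaign (cell `pub-rhpf`, seat cand-7, gen 7): the FLOOR-RATE DICTIONARY, ODD SECTOR

Mechanism/rigidity campaign; **no RH claims**.  Everything here is PROVED (Mathlib + tree theorems;
no named fact).  The odd twin of `PfPersistenceFloorRate.lean`: a floor with exponential ruler on the
ODD-sector ground energy `ε_od(a) = weilOddGroundEnergy a` bounds the critical strip at half the rate,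

* `abs_re_sub_half_le_of_odd_floor` — **if `-K e^{δa} ≤ ε_od(a)` for all `a > 0` (`δ ≥ 0`), then
  every non-trivial zero of `ζ` has `|Re ρ - 1/2| ≤ δ/2`**; eventual floors suffice
  (`…_eventually`); quasi-RH form `quasiRiemannHypothesis_of_odd_floor`;
* the consequences at rate `δ = 0` (RH ⟺ `ε_od` bounded below on `a > 0`), the exponential sinking
  off RH and the dichotomy `(∀ a, ε_od a ≥ 0) ∨ ε_od → -∞` are drawn in
  `PfPersistenceFloorRateDichotomy.lean` (§10) together with the even ones.

Mechanism.  For an EVEN real test `g` on `[-r, r]` the centred ANTISYMMETRIC translate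
`k(t) = (g(t - x/2) - g(t + x/2))/2` is ODD, lives on the window `r + |x|/2`, has `∫|k|² ≤ ∫|g|²` and
zero-side form `Q(k) = (Q(g) - Re B_g(x))/2` (`zeroForm_antiTranslate`: `conj` of the transform factor
at `1 - ρ̄` is MINUS the factor), so the odd floor bounds `Re B_g(x)` from ABOVE
(`re_expSum_le_of_odd_floor`) and the one-sided engine `stub_evenEngine` on the NEGATED real series
`-e^{-δx/2} B_g(x)` kills every mode with `Re ρ > 1/2 + δ/2`; the even real bumps of
`stub_evenTestExists` finish.  Reference: E. Bombieri, Rend. Lincei (9) 11 (2000) 183–233, §4 Thm. 5.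
-/

set_option linter.dupNamespace false

noncomputable section
open Complex MeasureTheory Filter Set
open scoped Real Topology ComplexConjugate

namespace Summit.RiemannHypothesis.RiemannHypothesis.Theorems.PfPersistenceFloorRateOdd

open Literature.NumberTheory.LFunctions
open Summit.RiemannHypothesis.RiemannHypothesis.Theorems.RuelleBandExactFirstBand

/-! ## §1 The antisymmetric translate `(g(t-x) - g(t+x))/2` -/

/-- The antisymmetric translate is half the difference of the two translates. [folklore] -/
theorem antiTranslate_eq_weilTranslate (g : ℝ → ℂ) (x : ℝ) :
    (fun t : ℝ => (g (t - x) - g (t + x)) / 2) =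
      fun t : ℝ => (1 / 2 : ℂ) *
        (weilTranslate g x + fun u : ℝ => (-1 : ℂ) * weilTranslate g (-x) u) t := by
  funext t
  simp only [Pi.add_apply, weilTranslate, sub_neg_eq_add]
  ring

/-- The antisymmetric translate of a test function is a test function. [folklore] -/
theorem isWeilTest_antiTranslate {g : ℝ → ℂ} (hg : IsWeilTest g) (x : ℝ) :
    IsWeilTest (fun t : ℝ => (g (t - x) - g (t + x)) / 2) := by
  rw [antiTranslate_eq_weilTranslate]
  exact ((hg.weilTranslate x).add ((hg.weilTranslate (-x)).const_mul (-1))).const_mul (1 / 2)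

/-- The antisymmetric translate of an EVEN function is ODD. [folklore] -/
theorem antiTranslate_odd {g : ℝ → ℂ} (he : ∀ t : ℝ, g (-t) = g t) (x t : ℝ) :
    (g (-t - x) - g (-t + x)) / 2 = -((g (t - x) - g (t + x)) / 2) := by
  rw [show -t - x = -(t + x) by ring, show -t + x = -(t - x) by ring, he, he]
  ring

/-- Support of the antisymmetric translate: inside `[-(r + |x|), r + |x|]`. [folklore] -/
theorem tsupport_antiTranslate_subset {g : ℝ → ℂ} {r : ℝ} (hsupp : tsupport g ⊆ Icc (-r) r)
    (x : ℝ) : tsupport (fun t : ℝ => (g (t - x) - g (t + x)) / 2) ⊆ Icc (-(r + |x|)) (r + |x|) := by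
  refine closure_minimal (fun t ht ↦ ?_) isClosed_Icc
  by_contra hmem
  apply ht
  have hg0 : ∀ y : ℝ, r < |y| → g y = 0 := fun y hy ↦
    image_eq_zero_of_notMem_tsupport fun hys ↦ by
      have h := hsupp hys
      rw [mem_Icc] at h
      have : |y| ≤ r := abs_le.2 ⟨h.1, h.2⟩
      linarith
  have ht' : r + |x| < |t| := by
    rw [mem_Icc, not_and_or, not_le, not_le] at hmem
    rcases hmem with h | h
    · rcases le_or_gt 0 t with ht0 | ht0
      · rw [abs_of_nonneg ht0]; linarith
      · rw [abs_of_neg ht0]; linarith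
    · exact lt_of_lt_of_le h (le_abs_self t)
  have h1 : g (t - x) = 0 := hg0 (t - x) (by
    have := abs_sub_abs_le_abs_sub t x
    linarith)
  have h2 : g (t + x) = 0 := hg0 (t + x) (by
    have := abs_sub_abs_le_abs_sub t (-x)
    rw [abs_neg, sub_neg_eq_add] at this
    linarith)
  simp [h1, h2]

/-- `∫ |(g(t-x) - g(t+x))/2|² ≤ ∫ |g|²`. [folklore] -/
theorem integral_norm_sq_antiTranslate_le {g : ℝ → ℂ} (hg : IsWeilTest g) (x : ℝ) :
    ∫ t, ‖(g (t - x) - g (t + x)) / 2‖ ^ 2 ≤ ∫ t, ‖g t‖ ^ 2 := by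
  have h2 : Integrable fun t : ℝ ↦ ‖g t‖ ^ 2 := hg.integrable_norm_sq
  have hm : Integrable fun t : ℝ ↦ ‖g (t - x)‖ ^ 2 := h2.comp_sub_right x
  have hp : Integrable fun t : ℝ ↦ ‖g (t + x)‖ ^ 2 := h2.comp_add_right x
  calc ∫ t, ‖(g (t - x) - g (t + x)) / 2‖ ^ 2
      ≤ ∫ t, (‖g (t - x)‖ ^ 2 + ‖g (t + x)‖ ^ 2) / 2 := by
        refine integral_mono_of_nonneg (Eventually.of_forall fun _ ↦ by positivity)
          ((hm.add hp).div_const 2) (Eventually.of_forall fun t ↦ ?_)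
        have hn : ‖(g (t - x) - g (t + x)) / 2‖ ≤ (‖g (t - x)‖ + ‖g (t + x)‖) / 2 := by
          rw [norm_div, Complex.norm_two]
          exact div_le_div_of_nonneg_right (norm_sub_le _ _) zero_le_two
        calc ‖(g (t - x) - g (t + x)) / 2‖ ^ 2 ≤ ((‖g (t - x)‖ + ‖g (t + x)‖) / 2) ^ 2 :=
              pow_le_pow_left₀ (norm_nonneg _) hn 2
          _ ≤ (‖g (t - x)‖ ^ 2 + ‖g (t + x)‖ ^ 2) / 2 := by
              nlinarith [sq_nonneg (‖g (t - x)‖ - ‖g (t + x)‖)]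
    _ = ∫ t, ‖g t‖ ^ 2 := by
        rw [integral_div, integral_add hm hp,
          integral_sub_right_eq_self (fun u : ℝ ↦ ‖g u‖ ^ 2) x,
          integral_add_right_eq_self (fun u : ℝ ↦ ‖g u‖ ^ 2) x]
        ring

/-- Transform of the antisymmetric translate: `k̂_x(s) = ĝ(s)·(e^{(s-1/2)x} - e^{-(s-1/2)x})/2`. [folklore] -/
theorem weilMellin_antiTranslate {g : ℝ → ℂ} (hg : IsWeilTest g) (x : ℝ) (s : ℂ) :
    weilMellin (fun t : ℝ => (g (t - x) - g (t + x)) / 2) s =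
      weilMellin g s * ((cexp ((s - 1 / 2) * x) - cexp (-((s - 1 / 2) * x))) / 2) := by
  have h1 : IsWeilTest (weilTranslate g x) := hg.weilTranslate x
  have h2 : IsWeilTest (fun u : ℝ => (-1 : ℂ) * weilTranslate g (-x) u) :=
    (hg.weilTranslate (-x)).const_mul (-1)
  rw [antiTranslate_eq_weilTranslate, weilMellin_const_mul,
    weilMellin_add h1.1.continuous h1.2 h2.1.continuous h2.2, weilMellin_const_mul,
    weilMellin_weilTranslate, weilMellin_weilTranslate,
    show (s - 1 / 2) * (((-x : ℝ) : ℂ)) = -((s - 1 / 2) * (x : ℂ)) by push_cast; ring]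
  ring

/-- Termwise zero-side coefficient of the antisymmetric translate:
`P_{k_x}(ρ) = P_g(ρ) · (2 - e^{(ρ-1/2)·2x} - e^{(1/2-ρ)·2x}) / 4` — the conjugate of the transform
factor at `1 - ρ̄` is MINUS the factor at `ρ`. [folklore] -/
theorem pairCoeff_antiTranslate {g : ℝ → ℂ} (hg : IsWeilTest g) (x : ℝ) (ρ : ℂ) :
    WeilConverse.pairCoeff (fun t : ℝ => (g (t - x) - g (t + x)) / 2) ρ =
      WeilConverse.pairCoeff g ρ *
        ((2 - cexp ((ρ - 1 / 2) * ((2 * x : ℝ) : ℂ)) - cexp ((1 / 2 - ρ) * ((2 * x : ℝ) : ℂ))) / 4) := by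
  have hE2 : cexp ((ρ - 1 / 2) * x) * cexp ((ρ - 1 / 2) * x) = cexp ((ρ - 1 / 2) * ((2 * x : ℝ) : ℂ)) := by
    rw [← Complex.exp_add]
    congr 1
    push_cast
    ring
  have hE'2 : cexp (-((ρ - 1 / 2) * x)) * cexp (-((ρ - 1 / 2) * x)) =
      cexp ((1 / 2 - ρ) * ((2 * x : ℝ) : ℂ)) := by
    rw [← Complex.exp_add]
    congr 1
    push_cast
    ring
  have hEE' : cexp ((ρ - 1 / 2) * x) * cexp (-((ρ - 1 / 2) * x)) = 1 := by
    rw [← Complex.exp_add, ← Complex.exp_zero]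
    congr 1
    ring
  have hF : conj (cexp ((1 - conj ρ - 1 / 2) * x)) = cexp (-((ρ - 1 / 2) * x)) := by
    rw [← Complex.exp_conj]
    congr 1
    simp only [map_mul, map_sub, map_one, map_div₀, map_ofNat, Complex.conj_conj,
      Complex.conj_ofReal]
    ring
  have hF' : conj (cexp (-((1 - conj ρ - 1 / 2) * x))) = cexp ((ρ - 1 / 2) * x) := by
    rw [← Complex.exp_conj]
    congr 1
    simp only [map_neg, map_mul, map_sub, map_one, map_div₀, map_ofNat, Complex.conj_conj,
      Complex.conj_ofReal]
    ring
  rw [WeilConverse.pairCoeff, WeilConverse.pairCoeff, weilMellin_antiTranslate hg,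
    weilMellin_antiTranslate hg, map_mul, map_div₀, map_sub, hF, hF', map_ofNat]
  linear_combination
    weilMellin g ρ * conj (weilMellin g (1 - conj ρ)) / 4 * (2 * hEE' - hE2 - hE'2)

/-- Zero-side Weil form of the antisymmetric translate: `Q(k_x) = (Q(g) - Re B_g(2x))/2`. [folklore] -/
theorem zeroForm_antiTranslate {g : ℝ → ℂ} (hg : IsWeilTest g) (x : ℝ) :
    WeilConverse.zeroForm (fun t : ℝ => (g (t - x) - g (t + x)) / 2) =
      (WeilConverse.zeroForm g - (((WeilConverse.expSum g (2 * x)).re : ℝ) : ℂ)) / 2 := by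
  have hP := (WeilConverse.summable_pairCoeff hg).hasSum
  have hA := (WeilConverse.summable_expSum' hg (2 * x)).hasSum
  have hB := (WeilConverse.summable_expSum hg (2 * x)).hasSum
  have h := ((hP.mul_left 2).sub (hB.add hA)).div_const 4
  have hre : (((WeilConverse.expSum g (2 * x)).re : ℝ) : ℂ) =
      (WeilConverse.expSum g (2 * x) + WeilConverse.expSum' g (2 * x)) / 2 := by
    rw [expSum'_eq_conj_expSum, Complex.add_conj]
    push_cast
    ring
  rw [hre, WeilConverse.zeroForm]
  refine Eq.trans (tsum_congr fun ρ ↦ ?_) (h.tsum_eq.trans ?_)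
  · rw [pairCoeff_antiTranslate hg]
    ring
  · show (2 * WeilConverse.zeroForm g -
        (WeilConverse.expSum g (2 * x) + WeilConverse.expSum' g (2 * x))) / 4 = _
    ring

/-! ## §2 The odd floor bounds `Re B_g` from above -/

/-- **One-sided bound, odd sector.**  If `-K e^{δa} ≤ ε_od(a)` on `a > 0` (`K ≥ 0`) and `g` is an
EVEN test function supported in `[-r, r]`, `r > 0`, then for every real `x`
`Re B_g(x) ≤ Re Q(g) + 2K e^{δ(r + |x|/2)} ∫|g|²` (the floor at the window `r + |x|/2` applied to
the odd function `k = (g(· - x/2) - g(· + x/2))/2`, whose zero-side form is `(Q(g) - Re B_g(x))/2`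
and equals `W(k ⋆ k̃)` by the proved explicit formula). [folklore] -/
theorem re_expSum_le_of_odd_floor {K δ : ℝ} (hK : 0 ≤ K)
    (hL : ∀ a : ℝ, 0 < a → -(K * Real.exp (δ * a)) ≤ weilOddGroundEnergy a)
    {g : ℝ → ℂ} (hg : IsWeilTest g) (heven : ∀ t : ℝ, g (-t) = g t)
    {r : ℝ} (hr : 0 < r) (hsupp : tsupport g ⊆ Icc (-r) r) (x : ℝ) :
    (WeilConverse.expSum g x).re ≤
      (WeilConverse.zeroForm g).re + 2 * K * Real.exp (δ * (r + |x| / 2)) * ∫ t, ‖g t‖ ^ 2 := by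
  have hk : IsWeilTest (fun t : ℝ => (g (t - x / 2) - g (t + x / 2)) / 2) :=
    isWeilTest_antiTranslate hg (x / 2)
  have hodd : ∀ t : ℝ, (fun t : ℝ => (g (t - x / 2) - g (t + x / 2)) / 2) (-t) =
      -(fun t : ℝ => (g (t - x / 2) - g (t + x / 2)) / 2) t := fun t ↦
    antiTranslate_odd heven (x / 2) t
  have hsupp' : tsupport (fun t : ℝ => (g (t - x / 2) - g (t + x / 2)) / 2) ⊆
      Icc (-(r + |x| / 2)) (r + |x| / 2) := by
    have h := tsupport_antiTranslate_subset hsupp (x / 2)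
    rwa [abs_div, abs_two] at h
  have ha : 0 < r + |x| / 2 := by positivity
  have hQW : WeilConverse.zeroForm (fun t : ℝ => (g (t - x / 2) - g (t + x / 2)) / 2) =
      weilQuadratic (fun t : ℝ => (g (t - x / 2) - g (t + x / 2)) / 2) :=
    tendsto_nhds_unique (WeilConverse.hasWeilZeroSide_zeroForm hk)
      (explicit_formula_holds (hk.weilConv hk.weilReflect))
  have hfloor := weilOddGroundEnergy_mul_le_re hk hsupp' hodd
  have hN := integral_norm_sq_antiTranslate_le hg (x / 2)
  have hN0 : 0 ≤ ∫ t, ‖(g (t - x / 2) - g (t + x / 2)) / 2‖ ^ 2 :=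
    integral_nonneg fun _ ↦ by positivity
  have hE0 : 0 ≤ K * Real.exp (δ * (r + |x| / 2)) := by positivity
  have h1 : -(K * Real.exp (δ * (r + |x| / 2))) * ∫ t, ‖g t‖ ^ 2 ≤
      weilOddGroundEnergy (r + |x| / 2) * ∫ t, ‖(g (t - x / 2) - g (t + x / 2)) / 2‖ ^ 2 :=
    calc -(K * Real.exp (δ * (r + |x| / 2))) * ∫ t, ‖g t‖ ^ 2
        ≤ -(K * Real.exp (δ * (r + |x| / 2))) * ∫ t, ‖(g (t - x / 2) - g (t + x / 2)) / 2‖ ^ 2 :=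
          mul_le_mul_of_nonpos_left hN (by linarith)
      _ ≤ _ := mul_le_mul_of_nonneg_right (hL _ ha) hN0
  have h2 := h1.trans hfloor
  rw [← hQW, zeroForm_antiTranslate hg, show 2 * (x / 2) = x by ring, Complex.div_ofNat_re,
    Complex.sub_re, Complex.ofReal_re] at h2
  linarith

/-! ## §3 The engine on the negated series: no modes beyond the half-rate -/

/-- **No modes with `Re ρ > 1/2 + δ/2` under an odd floor** (`K, δ ≥ 0`; `g` even test): the engine
`stub_evenEngine` applied to the REAL series `-e^{-δx/2} B_g(x) = Σ_ρ (-m(ρ) P_g(ρ)) e^{(ρ-1/2-δ/2)x}`,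
bounded below on `x ≥ 0` by §2. [folklore] -/
theorem order_mul_pairCoeff_eq_zero_of_odd_floor {K δ : ℝ} (hK : 0 ≤ K) (hδ : 0 ≤ δ)
    (hL : ∀ a : ℝ, 0 < a → -(K * Real.exp (δ * a)) ≤ weilOddGroundEnergy a)
    {g : ℝ → ℂ} (hg : IsWeilTest g) (heven : ∀ t : ℝ, g (-t) = g t)
    {ρ₀ : ℂ} (hρ₀ : ρ₀ ∈ ZetaZeros.riemannZetaNontrivialZeros) (hre : 1 / 2 + δ / 2 < ρ₀.re) :
    (riemannZetaZeroOrder ρ₀ : ℂ) * WeilConverse.pairCoeff g ρ₀ = 0 := by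
  obtain ⟨r, hr, hsupp⟩ := hg.exists_tsupport_subset_Icc
  set Q₀ : ℝ := (WeilConverse.zeroForm g).re with hQ₀
  set N₀ : ℝ := ∫ t, ‖g t‖ ^ 2 with hN₀
  have hN₀0 : 0 ≤ N₀ := integral_nonneg fun _ ↦ by positivity
  have hBreal : ∀ y : ℝ, (WeilConverse.expSum g y).im = 0 := fun y ↦
    ((stub_evenExpSum g hg heven).2 y).2
  have hB : ∀ y : ℝ, (WeilConverse.expSum g y).re ≤
      Q₀ + 2 * K * Real.exp (δ * (r + |y| / 2)) * N₀ :=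
    fun y ↦ re_expSum_le_of_odd_floor hK hL hg heven hr hsupp y
  have hF : ∀ x : ℝ, ∑' ρ : ZetaZeros.riemannZetaNontrivialZeros,
      -((riemannZetaZeroOrder (ρ : ℂ) : ℂ) * WeilConverse.pairCoeff g ρ) *
        cexp (((ρ : ℂ) - 1 / 2 - δ / 2) * x) =
      -(((Real.exp (-(δ / 2 * x)) : ℝ) : ℂ) * WeilConverse.expSum g x) := by
    intro x
    rw [WeilConverse.expSum, ← tsum_mul_left, ← tsum_neg]
    refine tsum_congr fun ρ ↦ ?_
    rw [Complex.ofReal_exp,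
      show (((ρ : ℂ) - 1 / 2 - δ / 2) * x : ℂ) = ((-(δ / 2 * x) : ℝ) : ℂ) + ((ρ : ℂ) - 1 / 2) * x by
        push_cast; ring,
      Complex.exp_add]
    ring
  have h := stub_evenEngine ZetaZeros.riemannZetaNontrivialZeros
    (fun ρ : ZetaZeros.riemannZetaNontrivialZeros ↦
      -((riemannZetaZeroOrder (ρ : ℂ) : ℂ) * WeilConverse.pairCoeff g ρ))
    (fun ρ : ZetaZeros.riemannZetaNontrivialZeros ↦ (ρ : ℂ) - 1 / 2 - δ / 2) (1 / 2)
    (max Q₀ 0 + 2 * K * Real.exp (δ * r) * N₀)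
    (by simpa only [norm_neg] using WeilConverse.summable_norm_pairCoeff hg)
    (fun ρ ↦ ?_) (fun z ↦ ?_) (fun ρ _ ↦ ?_) (fun x hx ↦ ?_) (fun x hx ↦ ?_) (ρ₀ - 1 / 2 - δ / 2)
    ?_ {⟨ρ₀, hρ₀⟩} (fun ρ ↦ ?_)
  · simpa using h
  · have h1 := (le_abs_self _).trans (WeilConverse.abs_re_sub_half_le ρ.2)
    have h2 : ((ρ : ℂ) - 1 / 2 - δ / 2).re = ((ρ : ℂ) - 1 / 2).re - δ / 2 := by
      simp [Complex.sub_re]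
    rw [h2]
    linarith
  · refine ⟨1, one_pos, ?_⟩
    refine ((riemannZetaNontrivialZeros_finite_inter_ball (z + 1 / 2 + δ / 2) 1).preimage
      (Subtype.val_injective.injOn)).subset fun ρ hρ ↦ ?_
    simp only [mem_setOf_eq, Metric.mem_ball, dist_eq_norm] at hρ
    refine ⟨ρ.2, ?_⟩
    rw [Metric.mem_ball, dist_eq_norm]
    rwa [show (ρ : ℂ) - (z + 1 / 2 + δ / 2) = (ρ : ℂ) - 1 / 2 - δ / 2 - z by ring]
  · simpa [Complex.sub_im] using ZetaZeros.riemannZetaNontrivialZeros.im_ne_zero ρ.2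
  · rw [hF x, Complex.neg_im, Complex.im_ofReal_mul, hBreal x, mul_zero, neg_zero]
  · rw [hF x, Complex.neg_re, Complex.re_ofReal_mul]
    have hBx := hB x
    rw [abs_of_nonneg hx] at hBx
    set e : ℝ := Real.exp (-(δ / 2 * x)) with he
    have he0 : 0 < e := Real.exp_pos _
    have he1 : e ≤ 1 := Real.exp_le_one_iff.2 (by nlinarith)
    have hee : e * Real.exp (δ * (r + x / 2)) = Real.exp (δ * r) := by
      rw [he, ← Real.exp_add]
      congr 1
      ring
    have h1 : e * (WeilConverse.expSum g x).re ≤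
        e * (Q₀ + 2 * K * Real.exp (δ * (r + x / 2)) * N₀) :=
      mul_le_mul_of_nonneg_left hBx he0.le
    have h2 : e * Q₀ ≤ max Q₀ 0 :=
      calc e * Q₀ ≤ e * max Q₀ 0 := mul_le_mul_of_nonneg_left (le_max_left _ _) he0.le
        _ ≤ 1 * max Q₀ 0 := mul_le_mul_of_nonneg_right he1 (le_max_right _ _)
        _ = max Q₀ 0 := one_mul _
    have h3 : e * (Q₀ + 2 * K * Real.exp (δ * (r + x / 2)) * N₀) =
        e * Q₀ + 2 * K * (e * Real.exp (δ * (r + x / 2))) * N₀ := by ring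
    rw [h3, hee] at h1
    linarith
  · have h2 : (ρ₀ - 1 / 2 - (δ : ℂ) / 2).re = ρ₀.re - 1 / 2 - δ / 2 := by
      simp [Complex.sub_re]
    rw [h2]
    linarith
  · rw [Finset.mem_singleton, sub_left_inj, sub_left_inj]
    constructor
    · rintro rfl; rfl
    · intro h; exact Subtype.ext h

/-! ## §4 The odd dictionary -/

/-- Right half: under the odd floor with rate `δ ≥ 0`, `Re ρ ≤ 1/2 + δ/2`. [folklore] -/
theorem re_le_of_odd_floor {K δ : ℝ} (hδ : 0 ≤ δ)
    (hL : ∀ a : ℝ, 0 < a → -(K * Real.exp (δ * a)) ≤ weilOddGroundEnergy a)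
    {ρ : ℂ} (hρ : ρ ∈ ZetaZeros.riemannZetaNontrivialZeros) : ρ.re ≤ 1 / 2 + δ / 2 := by
  have hL' : ∀ a : ℝ, 0 < a → -(max K 0 * Real.exp (δ * a)) ≤ weilOddGroundEnergy a :=
    fun a ha ↦ le_trans (neg_le_neg (mul_le_mul_of_nonneg_right (le_max_left _ _)
      (Real.exp_pos _).le)) (hL a ha)
  by_contra hre
  rw [not_le] at hre
  obtain ⟨g, hg, heven, hreal, hg0⟩ := stub_evenTestExists ρ
  have h := order_mul_pairCoeff_eq_zero_of_odd_floor (le_max_right _ _) hδ hL' hg heven hρ hre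
  have hm : (riemannZetaZeroOrder ρ : ℂ) ≠ 0 := by
    have := ZetaZeros.riemannZetaNontrivialZeros.one_le_order hρ
    exact_mod_cast (by omega : riemannZetaZeroOrder ρ ≠ 0)
  rw [stub_evenTransfer_pairCoeff heven hreal, mul_eq_zero, or_iff_right hm] at h
  exact hg0 (mul_self_eq_zero.1 h)

/-- **FLOOR-RATE DICTIONARY, ODD SECTOR.** `-K e^{δa} ≤ ε_od(a)` (`a > 0`, `δ ≥ 0`) ⇒ `|Re ρ - 1/2| ≤ δ/2`. [folklore] -/
theorem abs_re_sub_half_le_of_odd_floor {K δ : ℝ} (hδ : 0 ≤ δ)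
    (hL : ∀ a : ℝ, 0 < a → -(K * Real.exp (δ * a)) ≤ weilOddGroundEnergy a)
    {ρ : ℂ} (hρ : ρ ∈ ZetaZeros.riemannZetaNontrivialZeros) : |ρ.re - 1 / 2| ≤ δ / 2 := by
  have h1 := re_le_of_odd_floor hδ hL hρ
  have h2 := re_le_of_odd_floor hδ hL (ZetaZeros.riemannZetaNontrivialZeros.one_sub_conj_mem hρ)
  rw [WeilConverse.one_sub_conj_re] at h2
  rw [abs_le]
  constructor <;> linarith

/-- Eventual odd floors are floors on every window (`weilOddGroundEnergy_antitone`). [folklore] -/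
theorem odd_floor_of_eventually {K δ a₀ : ℝ} (hδ : 0 ≤ δ)
    (hL : ∀ a : ℝ, a₀ ≤ a → -(K * Real.exp (δ * a)) ≤ weilOddGroundEnergy a) :
    ∃ K' : ℝ, 0 ≤ K' ∧ ∀ a : ℝ, 0 < a → -(K' * Real.exp (δ * a)) ≤ weilOddGroundEnergy a := by
  set a₁ : ℝ := max a₀ 1 with ha₁def
  have hK : K ≤ max K 0 := le_max_left _ _
  have ha₁ : 0 < a₁ := lt_of_lt_of_le one_pos (le_max_right _ _)
  refine ⟨max K 0 * Real.exp (δ * a₁), by positivity, fun a ha ↦ ?_⟩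
  have hEa0 : 0 ≤ Real.exp (δ * a) := (Real.exp_pos _).le
  rcases le_or_gt a₁ a with h | h
  · have h0 := hL a ((le_max_left _ _).trans h)
    have hE₁ : 1 ≤ Real.exp (δ * a₁) := Real.one_le_exp (by positivity)
    have h2 : K * Real.exp (δ * a) ≤ max K 0 * Real.exp (δ * a₁) * Real.exp (δ * a) := by
      calc K * Real.exp (δ * a) ≤ max K 0 * Real.exp (δ * a) := mul_le_mul_of_nonneg_right hK hEa0
        _ = max K 0 * 1 * Real.exp (δ * a) := by ring
        _ ≤ max K 0 * Real.exp (δ * a₁) * Real.exp (δ * a) := by gcongr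
    linarith
  · have hanti : weilOddGroundEnergy a₁ ≤ weilOddGroundEnergy a :=
      weilOddGroundEnergy_antitone ha h.le
    have h0 := hL a₁ (le_max_left _ _)
    have hEa : 1 ≤ Real.exp (δ * a) := Real.one_le_exp (by positivity)
    have h2 : K * Real.exp (δ * a₁) ≤ max K 0 * Real.exp (δ * a₁) * Real.exp (δ * a) := by
      calc K * Real.exp (δ * a₁) ≤ max K 0 * Real.exp (δ * a₁) :=
            mul_le_mul_of_nonneg_right hK (Real.exp_pos _).le
        _ = max K 0 * Real.exp (δ * a₁) * 1 := by ring
        _ ≤ max K 0 * Real.exp (δ * a₁) * Real.exp (δ * a) := by gcongr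
    linarith

/-- Eventual odd floors suffice: `-K e^{δa} ≤ ε_od(a)` for `a ≥ a₀` ⇒ `|Re ρ - 1/2| ≤ δ/2`. [folklore] -/
theorem abs_re_sub_half_le_of_odd_floor_eventually {K δ a₀ : ℝ} (hδ : 0 ≤ δ)
    (hL : ∀ a : ℝ, a₀ ≤ a → -(K * Real.exp (δ * a)) ≤ weilOddGroundEnergy a)
    {ρ : ℂ} (hρ : ρ ∈ ZetaZeros.riemannZetaNontrivialZeros) : |ρ.re - 1 / 2| ≤ δ / 2 := by
  obtain ⟨K', -, hK'⟩ := odd_floor_of_eventually hδ hL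
  exact abs_re_sub_half_le_of_odd_floor hδ hK' hρ

/-- Quasi-RH from an odd floor. [folklore] -/
theorem quasiRiemannHypothesis_of_odd_floor {K δ a₀ : ℝ} (hδ : 0 ≤ δ)
    (hL : ∀ a : ℝ, a₀ ≤ a → -(K * Real.exp (δ * a)) ≤ weilOddGroundEnergy a) :
    QuasiRiemannHypothesis (1 / 2 + δ / 2) := by
  intro s hs h0 h1
  have hmem : s ∈ ZetaZeros.riemannZetaNontrivialZeros :=
    ZetaZeros.riemannZetaNontrivialZeros.mem_iff'.2 ⟨hs, by linarith, h1⟩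
  have h := abs_re_sub_half_le_of_odd_floor_eventually hδ hL hmem
  rw [abs_le] at h
  linarith [h.2]

end Summit.RiemannHypothesis.RiemannHypothesis.Theorems.PfPersistenceFloorRateOdd

end
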